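import Summits.BirchSwinnertonDyer.BirchSwinnertonDyer.Theorems.ByReductionTypeAtTwoAdditiveKatoTransportPrintExactAnyImageModelDoors
import Summits.BirchSwinnertonDyer.BirchSwinnertonDyer.Theorems.ByReductionTypeAtTwoAdditiveKatoTransportQuadraticLayerPrint
import Summits.BirchSwinnertonDyer.BirchSwinnertonDyer.Theorems.ByReductionTypeAtTwoAdditiveKatoTransportQuadraticTwistModel
import Literature.NumberTheory.EllipticCurves.Kato2004.IwasawaCohomologyExistsProofs
import HarnessLib

/-!
# Route ByReductionTypeAtTwo, crux C4″ `AdditivePotMultOverKAtTwo` (stmt-BirchSwinnertonDyer-22618; parent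
# `AdditiveRankZeroAtTwo` 19098) — R17, part 4: the four split-twist block doors AT PRINT LEVEL — Kato's divisibility
# `ℓ_𝔮(X(W₁/ℚ_∞)) ≤ ℓ_𝔮(Λ/(L̃))` at EVERY height-one `𝔮 ∌ 2` (blocks (−1)/(−2); at `W` and at every `ℚ`-isogenous member `W₁`;
# keys `γ` and `γ⁻¹`; ANY image of `ρ̄_{W,2}`; exceptional prime included; functional equation in the kernel) keyed by
# {`Kato2004.thm12_4`, Greenberg Thm. 1.14 over `ℚ` and over `F`, Greenberg Thm. 1.5 over `ℚ`} BY NAME (PRINT) + the ONE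
# image-free odd-branch input + curve/field DATA only (theorems only)

Cell `bsd-2adic`, seat `bsd-2adic-k4-w3` GEN 5. Composition of this seat's image-free doors modulo the model
(`…PrintExactAnyImageModelDoors`, p706681: `hdec`, `hXι`, `hirr`, `hmult′`, `hD₀`, `hD₀′`, `Module.Finite` discharged — the
torsion of `X(W/ℚ_∞)` from the ONE input, `…PrintExactAnyImageTorsion` p705057) with seat t42 GEN 24's kernel supplies: the
model identification for EVERY imaginary quadratic field (`AddKatoTwoQuadLayerTwist.exists_selmerInfty_model_of_sq_eq`, p705602),
and «`W′` split multiplicative at `2` ⟹ `(W′)_F` split multiplicative above `2`» (`AddKatoTwoQuadLayerModel.hasSplitMultiplicativeReductionAt_baseChange_of_two_mem`,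
p705228); `𝐇¹_Γ(T₂W)` exists (`Kato2004.nonempty_iwasawaH1Data_holds`). What remains displayed besides the four PRINT facts and
the ONE typed input is DATA: the curve `W` (globally minimal, additive split-twist at `2`), a globally minimal `ℚ`-model `W′` of
its twist with `V • W = W′^{(d)}`, a square root `θ ∈ ℚ̄` of `d` fixed by the generator `γ` (WLOG, `SelmerDualData.rekey`), a newform
`f` of `W^{(d)}`, a quadratic field `F ∋ θ_F` with `θ_F² = d` (any model of `ℚ(√d)`), and an integral multiple `L̃ = 2^m·L⁻ ≠ 0`
of the odd branch (`d = −1`) resp. the `ω·χ₂`-branch (`d = −2`) of the one-term Mazur–Tate–Teitelbaum measure of `W′`.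

* §1 (−1)-block (`d = −1`, `F = ℚ(√−1)`): **`katoDivisibility_negOneSplitTwist_two_of_print_of_input`** — ONE theorem giving the
  divisibility for every key-`γ` datum, every key-`γ⁻¹` datum, and every key-`γ` datum of every `W₁ ∼_ℚ W` (Kato's member `W_K`
  of the reducible block).
* §2 (−2)-block (`d = −2`, `F = ℚ(√−2)`): **`katoDivisibility_negTwoSplitTwist_two_of_print_of_input`** — the same three clauses,
  keyed by the ONE `(−1)` input through R15 (`AddKatoTwoGammaTwist.katoOddBranchInputsNegTwoPrintExactAnyImage_of_negOne`).

HONEST FRAMING (D-0036 / D-0054): theorems only — no definition, no named fact, no instance, no `sorry`; route-independent;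
CONDITIONAL on `Kato2004.thm12_4`, `Greenberg1999_thm114_charIdeal_iota_invariant`,
`Greenberg1999.thm114_charIdeal_iota_invariant_splitMult_baseChange`, `Greenberg1999.thm15_isTorsion_multiplicative_rat` (PRINT,
hypotheses BY NAME) and on the typed input `KatoOddBranchInputsAtTwoNegOneSplitTwistPrintExactAnyImage` (conjecture-grade at `2`:
Coleman clause of the odd branch beyond print); types-the-object-of (the Iwasawa-level word of all four split-twist blocks of C4″
becomes «PRINT ×4 + ONE typed input + data»); closes none (the block targets `KatoSharpAtTwoAdditiveNeg{One,Two}SplitTwist` /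
`KatoMemberSharp…Reducible` still need the descent READING T1–T14 / R1–R13 and, on the irreducible blocks, (A)); nothing booked;
BSD is not proved by any of this. PARTITION: X5@2 additive potentially-multiplicative block, the four split-twist sub-blocks
(169 + 39 classes) × `p = 2`.

References: [Kato2004Asterisque] Thm. 12.4 (p. 221), Thm. 12.5 (3) with (12.5.1) (p. 222), Thm. 17.4 (1) (p. 273), §17.13
(pp. 279–280); [GreenbergLNM1716] §1 (p. 60), Thm. 1.5 (p. 61), Thm. 1.14 (p. 68), §2, §4 (p. 107); [Greenberg1989] pp. 101–102;
[GreenbergVatsal2000] §2 (p. 28); [SilvermanAEC2009] VII.5 Prop. 5.1 (b), X.5 Cor. 5.4; [MazurTateTeitelbaum1986Invent] §I.13,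
§I.17; memos `run/shared/lean/pub/bsd-2adic/k4w3/gen5/VERDICT-22618-k4w3-GEN5.md`, `…/t42/DESIGN-T42-ADDENDUM-28.md`.
-/

set_option autoImplicit false
-- the summit's namespace `Summit.BirchSwinnertonDyer.BirchSwinnertonDyer` (Sub = Summit) trips `dupNamespace`
set_option linter.dupNamespace false

noncomputable section

open scoped Classical MatrixGroups ModularForm NumberField

open Field CongruenceSubgroup WeierstrassCurve IsDedekindDomain Literature.NumberTheory.EllipticCurves
  Literature.NumberTheory.EllipticCurves.ModularForms Literature.NumberTheory.EllipticCurves.IwasawaAlgebra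
  Literature.NumberTheory.EllipticCurves.Module Literature.NumberTheory.EllipticCurves.QuadraticLayer
  Literature.NumberTheory.EllipticCurves.Greenberg1999 Literature.NumberTheory.GaloisRepresentations
  Summit.BirchSwinnertonDyer.BirchSwinnertonDyer.Theorems

namespace Summit.BirchSwinnertonDyer.BirchSwinnertonDyer.Theorems.AddKatoTwo

/-! ## §1 The (−1)-block doors at print level -/

section NegOne

variable (W : WeierstrassCurve ℚ) [W.IsElliptic] [W.IsGloballyMinimal] [ContinuousSMul ℤ_[2] (W.tateModule 2)]
  (W' : WeierstrassCurve ℚ) [W'.IsElliptic] [W'.IsGloballyMinimal] {V : VariableChange ℚ} (hV : V • W = W'.quadraticTwist (-1))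
  {θ : AlgebraicClosure ℚ} (hθ : θ ^ 2 = algebraMap ℚ (AlgebraicClosure ℚ) (-1))
  {N : ℕ} [NeZero N] (f : CuspForm (Gamma0 N) 2) (κ : ZpExtension ℚ 2) (γ : absoluteGaloisGroup ℚ)
  (hsp : (W.quadraticTwist (-1)).HasSplitMultiplicativeReductionAtPrime 2)
  (hκ : κ.IsCyclotomic) (hγ : κ.IsTopGenerator γ) (hγ' : IsCyclotomicVariable 2 γ) (hγθ : γ • θ = θ)
  (hf : IsNewformOf (W.quadraticTwist (-1)) f)
  (Lt : IwasawaAlgebra 2) (m : ℕ)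
  (hLt : iwasawaToPowerSeries 2 Lt = PowerSeries.C ((2 : ℚ_[2]) ^ m) * padicLFunctionMinusBranchMult f (1 : ℚ_[2]) 1)
  (hLt0 : Lt ≠ 0)
  -- the quadratic field `F = ℚ(√−1)` (any model)
  (F : Type) [Field F] [NumberField F] {θF : F} (hθF : θF ^ 2 = -1) (hF2 : Module.finrank ℚ F = 2)

include hV hθ hsp hκ hγ hγ' hγθ hf hLt hLt0 hθF hF2 in
/-- **THE (−1)-BLOCK DOORS AT PRINT LEVEL, ANY image — key `γ`, key `γ⁻¹` and every `ℚ`-isogenous member at once**: for the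
ADDITIVE `W` whose twist by `−1` is split multiplicative at `2`, from {`Kato2004.thm12_4`, Greenberg Thm. 1.14 ×2, Greenberg
Thm. 1.5} (PRINT, BY NAME), the ONE image-free input, and DATA (`W′` with `V • W = W′^{(−1)}`, `θ`, `f`, `F ∋ θ_F` with
`θ_F² = −1`, `L̃ = 2^m·L⁻ ≠ 0`): (i) `ℓ_𝔮(X(W/ℚ_∞)) ≤ ℓ_𝔮(Λ/(L̃))` at every height-one `𝔮 ∌ 2` for every key-`γ` dual Selmer datum;
(ii) the same for every key-`γ⁻¹` datum (the PRINT-EXACT currency); (iii) the same for every key-`γ` datum of every `W₁ ∼_ℚ W`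
(Kato's member `W_K` of the reducible block — R14 (c)'s socket). Proof: `…_fe_of_quadraticField{,_of_isIsogenous}` /
`…Contra…_fe_of_quadraticField` (p706681) with `hF` SUPPLIED (`AddKatoTwoQuadLayerModel.hasSplitMultiplicativeReductionAt_baseChange_of_two_mem`,
t42 GEN 24, from `hasSplitMultiplicativeReductionAtPrime_twistModel`) and `I = 𝐇¹_Γ(T₂W)` SUPPLIED (`Kato2004.nonempty_iwasawaH1Data_holds`).
No `hirr`, no `hXι`/`hdec`, no torsion or finiteness binder, no model, no `F`-tower.
[cite: Kato2004Asterisque, Thm. 12.4 (p. 221), Thm. 12.5 (3) and (12.5.1) (p. 222), Thm. 17.4 (1) (p. 273), §8.3 (p. 181), §17.13 (pp. 279–280)]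
[cite: GreenbergLNM1716, Thm. 1.5 (p. 61), Thm. 1.14 (p. 68), §4 (p. 107)] [cite: GreenbergVatsal2000, §2 (p. 28)]
[cite: MazurTateTeitelbaum1986Invent, §I.17] [cite: Greenberg1989, pp. 101–102 (S^ι)] -/
theorem katoDivisibility_negOneSplitTwist_two_of_print_of_input (h12 : Kato2004.thm12_4)
    (hPE : KatoOddBranchInputsAtTwoNegOneSplitTwistPrintExactAnyImage) (h114 : Greenberg1999_thm114_charIdeal_iota_invariant)
    (h114F : Greenberg1999.thm114_charIdeal_iota_invariant_splitMult_baseChange) (h15 : thm15_isTorsion_multiplicative_rat) :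
    (∀ (D : W.SelmerDualData κ γ) (𝔮 : PrimeSpectrum (IwasawaAlgebra 2)), 𝔮.asIdeal.height = 1 →
      PowerSeries.C (2 : ℤ_[2]) ∉ 𝔮.asIdeal →
      lengthAt (IwasawaAlgebra 2) D.X 𝔮 ≤ lengthAt (IwasawaAlgebra 2) (IwasawaAlgebra 2 ⧸ Ideal.span {Lt}) 𝔮) ∧
    (∀ (D' : W.SelmerDualData κ γ⁻¹) (𝔮 : PrimeSpectrum (IwasawaAlgebra 2)), 𝔮.asIdeal.height = 1 →
      PowerSeries.C (2 : ℤ_[2]) ∉ 𝔮.asIdeal →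
      lengthAt (IwasawaAlgebra 2) D'.X 𝔮 ≤ lengthAt (IwasawaAlgebra 2) (IwasawaAlgebra 2 ⧸ Ideal.span {Lt}) 𝔮) ∧
    (∀ (W₁ : WeierstrassCurve ℚ) [W₁.IsElliptic], IsIsogenous W W₁ →
      ∀ (D₁ : W₁.SelmerDualData κ γ) (𝔮 : PrimeSpectrum (IwasawaAlgebra 2)), 𝔮.asIdeal.height = 1 →
      PowerSeries.C (2 : ℤ_[2]) ∉ 𝔮.asIdeal →
      lengthAt (IwasawaAlgebra 2) D₁.X 𝔮 ≤ lengthAt (IwasawaAlgebra 2) (IwasawaAlgebra 2 ⧸ Ideal.span {Lt}) 𝔮) := by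
  haveI : Fact (Nat.Prime 2) := ⟨Nat.prime_two⟩
  obtain ⟨I⟩ := Kato2004.nonempty_iwasawaH1Data_holds W 2 κ γ hκ hγ
  have hsp' : W'.HasSplitMultiplicativeReductionAtPrime 2 :=
    hasSplitMultiplicativeReductionAtPrime_twistModel W W' (by norm_num) hV 2 hsp
  have hF : ∀ v : HeightOneSpectrum (𝓞 F), (2 : 𝓞 F) ∈ v.asIdeal → (W'.baseChange F).HasSplitMultiplicativeReductionAt v :=
    fun v hv ↦ AddKatoTwoQuadLayerModel.hasSplitMultiplicativeReductionAt_baseChange_of_two_mem W' hsp' F v hv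
  refine ⟨?_, ?_, ?_⟩
  · exact lengthAt_selmerDual_le_of_oddBranchInputsPrintExactAnyImage_fe_of_quadraticField W W' hV hθ f κ γ hsp hκ hγ hγ' hγθ hf
      I Lt m hLt hLt0 h12 hPE h114 h114F h15 F hθF hF2 hF
  · exact lengthAt_selmerDualContra_le_of_oddBranchInputsPrintExactAnyImage_fe_of_quadraticField W W' hV hθ f κ γ hsp hκ hγ hγ'
      hγθ hf I Lt m hLt hLt0 h12 hPE h114 h114F h15 F hθF hF2 hF
  · intro W₁ _ hiso D₁ 𝔮 h𝔮 hp𝔮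
    exact lengthAt_selmerDual_le_of_oddBranchInputsPrintExactAnyImage_fe_of_quadraticField_of_isIsogenous W W' hV hθ f κ γ hsp hκ
      hγ hγ' hγθ hf I Lt m hLt hLt0 h12 hPE h114 h114F h15 F hθF hF2 hF W₁ hiso D₁ 𝔮 h𝔮 hp𝔮

end NegOne

/-! ## §2 The (−2)-block doors at print level, keyed by the ONE `(−1)` input -/

section NegTwo

variable (W : WeierstrassCurve ℚ) [W.IsElliptic] [W.IsGloballyMinimal] [ContinuousSMul ℤ_[2] (W.tateModule 2)]
  (W' : WeierstrassCurve ℚ) [W'.IsElliptic] [W'.IsGloballyMinimal] {V : VariableChange ℚ} (hV : V • W = W'.quadraticTwist (-2))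
  {θ : AlgebraicClosure ℚ} (hθ : θ ^ 2 = algebraMap ℚ (AlgebraicClosure ℚ) (-2))
  {N : ℕ} [NeZero N] (f : CuspForm (Gamma0 N) 2) (κ : ZpExtension ℚ 2) (γ : absoluteGaloisGroup ℚ)
  (hsp : (W.quadraticTwist (-2)).HasSplitMultiplicativeReductionAtPrime 2)
  (hκ : κ.IsCyclotomic) (hγ : κ.IsTopGenerator γ) (hγ' : IsCyclotomicVariable 2 γ) (hγθ : γ • θ = θ)
  (hf : IsNewformOf (W.quadraticTwist (-2)) f)
  (Lt : IwasawaAlgebra 2) (m : ℕ)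
  (hLt : iwasawaToPowerSeries 2 Lt =
    PowerSeries.C ((2 : ℚ_[2]) ^ m) * padicLFunctionMinusBranchMultTwist f (1 : ℚ_[2]) 1 (-1))
  (hLt0 : Lt ≠ 0)
  -- the quadratic field `F = ℚ(√−2)` (any model)
  (F : Type) [Field F] [NumberField F] {θF : F} (hθF : θF ^ 2 = -2) (hF2 : Module.finrank ℚ F = 2)

include hθF in
/-- `θ_F² = −2` in `algebraMap` form. [folklore] -/
private theorem sq_eq_algebraMap_neg_two : θF ^ 2 = algebraMap ℚ F (-2) := by
  rw [hθF, map_neg, map_ofNat]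

include hV hθ hsp hκ hγ hγ' hγθ hf hLt hLt0 hθF hF2 in
/-- **THE (−2)-BLOCK DOORS AT PRINT LEVEL, ANY image, keyed by the ONE `(−1)` input — key `γ`, key `γ⁻¹` and every
`ℚ`-isogenous member at once**: for the ADDITIVE `W` whose twist by `−2` is split multiplicative at `2`, from {`Kato2004.thm12_4`,
Greenberg Thm. 1.14 ×2, Greenberg Thm. 1.5} (PRINT, BY NAME), `KatoOddBranchInputsAtTwoNegOneSplitTwistPrintExactAnyImage` (through
R15, `AddKatoTwoGammaTwist.katoOddBranchInputsNegTwoPrintExactAnyImage_of_negOne`), and DATA (`W′` with `V • W = W′^{(−2)}`, `θ`,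
`f`, `F ∋ θ_F` with `θ_F² = −2`, `L̃ = 2^m·L⁻₂ ≠ 0` for the `ω·χ₂`-branch): (i) key `γ`, (ii) key `γ⁻¹`, (iii) every `W₁ ∼_ℚ W`
(Kato's member of the reducible (−2)-block). Proof: `…_negTwo_fe_of_model{,_of_isIsogenous}` / `…Contra…_negTwo_fe_of_model`
(p706681) with the model SUPPLIED by `AddKatoTwoQuadLayerTwist.exists_selmerInfty_model_of_sq_eq` (t42 GEN 24, every `d < 0`),
`hF` SUPPLIED (`hasSplitMultiplicativeReductionAt_baseChange_of_two_mem`), `I` SUPPLIED (`Kato2004.nonempty_iwasawaH1Data_holds`).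
[cite: Kato2004Asterisque, Thm. 12.4 (p. 221), Thm. 12.5 (3) and (12.5.1) (p. 222), Thm. 17.4 (1) (p. 273), §8.3 (p. 181), §17.13 (pp. 279–280)]
[cite: GreenbergLNM1716, Thm. 1.5 (p. 61), Thm. 1.14 (p. 68), §4 (p. 107)] [cite: GreenbergVatsal2000, §2 (p. 28)]
[cite: MazurTateTeitelbaum1986Invent, §I.13, §I.17] [cite: Greenberg1989, pp. 101–102 (S^ι)] -/
theorem katoDivisibility_negTwoSplitTwist_two_of_print_of_input (h12 : Kato2004.thm12_4)
    (hPE : KatoOddBranchInputsAtTwoNegOneSplitTwistPrintExactAnyImage) (h114 : Greenberg1999_thm114_charIdeal_iota_invariant)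
    (h114F : Greenberg1999.thm114_charIdeal_iota_invariant_splitMult_baseChange) (h15 : thm15_isTorsion_multiplicative_rat) :
    (∀ (D : W.SelmerDualData κ γ) (𝔮 : PrimeSpectrum (IwasawaAlgebra 2)), 𝔮.asIdeal.height = 1 →
      PowerSeries.C (2 : ℤ_[2]) ∉ 𝔮.asIdeal →
      lengthAt (IwasawaAlgebra 2) D.X 𝔮 ≤ lengthAt (IwasawaAlgebra 2) (IwasawaAlgebra 2 ⧸ Ideal.span {Lt}) 𝔮) ∧
    (∀ (D' : W.SelmerDualData κ γ⁻¹) (𝔮 : PrimeSpectrum (IwasawaAlgebra 2)), 𝔮.asIdeal.height = 1 →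
      PowerSeries.C (2 : ℤ_[2]) ∉ 𝔮.asIdeal →
      lengthAt (IwasawaAlgebra 2) D'.X 𝔮 ≤ lengthAt (IwasawaAlgebra 2) (IwasawaAlgebra 2 ⧸ Ideal.span {Lt}) 𝔮) ∧
    (∀ (W₁ : WeierstrassCurve ℚ) [W₁.IsElliptic], IsIsogenous W W₁ →
      ∀ (D₁ : W₁.SelmerDualData κ γ) (𝔮 : PrimeSpectrum (IwasawaAlgebra 2)), 𝔮.asIdeal.height = 1 →
      PowerSeries.C (2 : ℤ_[2]) ∉ 𝔮.asIdeal →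
      lengthAt (IwasawaAlgebra 2) D₁.X 𝔮 ≤ lengthAt (IwasawaAlgebra 2) (IwasawaAlgebra 2 ⧸ Ideal.span {Lt}) 𝔮) := by
  haveI : Fact (Nat.Prime 2) := ⟨Nat.prime_two⟩
  haveI : (kerStab κ θ).Normal := normal_kerStab κ hθ
  obtain ⟨I⟩ := Kato2004.nonempty_iwasawaH1Data_holds W 2 κ γ hκ hγ
  have hsp' : W'.HasSplitMultiplicativeReductionAtPrime 2 :=
    hasSplitMultiplicativeReductionAtPrime_twistModel W W' (by norm_num) hV 2 hsp
  have hF : ∀ v : HeightOneSpectrum (𝓞 F), (2 : 𝓞 F) ∈ v.asIdeal → (W'.baseChange F).HasSplitMultiplicativeReductionAt v :=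
    fun v hv ↦ AddKatoTwoQuadLayerModel.hasSplitMultiplicativeReductionAt_baseChange_of_two_mem W' hsp' F v hv
  obtain ⟨κF, γF, hκF, hγF, -, -, ΘS, hΘS⟩ := AddKatoTwoQuadLayerTwist.exists_selmerInfty_model_of_sq_eq κ hκ W' hθ hγ hγθ
    (by norm_num : (-2 : ℚ) < 0) F (sq_eq_algebraMap_neg_two F hθF) hF2
  have hD := lengthAt_selmerDual_le_of_oddBranchInputsPrintExactAnyImage_negTwo_fe_of_model W W' hV hθ f κ γ hsp hκ hγ hγ' hγθ
    hf I F hF κF γF hκF hγF ((W'.baseChange F).selmerDualData κF hγF) ΘS hΘS Lt m hLt hLt0 h12 hPE h114 h114F h15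
  refine ⟨hD, ?_, ?_⟩
  · exact lengthAt_selmerDualContra_le_of_oddBranchInputsPrintExactAnyImage_negTwo_fe_of_model W W' hV hθ f κ γ hsp hκ hγ hγ'
      hγθ hf I F hF κF γF hκF hγF ((W'.baseChange F).selmerDualData κF hγF) ΘS hΘS Lt m hLt hLt0 h12 hPE h114 h114F h15
  · intro W₁ _ hiso D₁ 𝔮 h𝔮 hp𝔮
    have hp𝔮' : PowerSeries.C ((2 : ℕ) : ℤ_[2]) ∉ 𝔮.asIdeal := by exact_mod_cast hp𝔮
    rw [← lengthAt_selmerDual_eq_of_isIsogenous hiso (W.selmerDualData κ hγ) D₁ 𝔮 hp𝔮']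
    exact hD (W.selmerDualData κ hγ) 𝔮 h𝔮 hp𝔮

end NegTwo

end Summit.BirchSwinnertonDyer.BirchSwinnertonDyer.Theorems.AddKatoTwo

end
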